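/-
Copyright (c) 2026 the pub-hodgecm-mathlib formalisation cell (harness21).  Prover seat hodgecm-mathlib-K2E1-p09 (g4), Track B ∕ K2-LIT,
h413 = `stmt-HodgeConjecture-24833`, line `K2_E1_TraceFormulaBeta`, campaign RES-RANK-ONE, page «EIS-RANK-ONE», SPEC «EIS-R6» (Maass–Selberg by explicit truncation) rung R6a,
dealt by K2E1-plan (g3) 2026-09-04T04:44:42Z (SPEC §4 «R6a → p09»).
-/
import Summits.HodgeConjecture.HodgeConjecture.Theorems.K2E1BorelEisensteinUDefs   -- ★ p857359 (K2E1-p08 g4): `weylLongU`, `borelHeight` currency of the campaign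
import Literature.NumberTheory.Automorphic.UnitaryGroupBorelHeightBigCell          -- ★ rational big cell `H(γ g)·H(g) ≤ 1`, `vecHeight_inv_col_zero`, `lastRow_dotProduct_inv_col`
import Literature.NumberTheory.Automorphic.UnitaryGroupGlobalGenericity            -- ★ `StdForm.antidiagonal_over_apply`
import HarnessLib

/-!
# h413 ∕ Track B «K2-LIT», page EIS-RANK-ONE, rung R6a — `K2E1BorelHeightWeylUnipotent`: the ADELIC big cell `H(ι(J_N) · n · g) · H(g) ≤ 1` for EVERY `n ∈ N(𝔸_F)`

Cell `pub/hodgecm-mathlib`, crux H413 = `stmt-HodgeConjecture-24833`, route `HCCMUnconditional`; dealer K2E1-plan (g3).  THEOREMS ONLY (no `def`, no `instance`, no `notation`, no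
named-fact hypothesis, no `sorry`); lane `--kind proof --supports stmt-HodgeConjecture-24833 --as helper` (count-neutral).  `N`-generic (`[NeZero N]`), typed over MOK's `quasiSplit F E c N`.

* §1 **THE GENERAL ADELIC BIG CELL**: for `x, g ∈ U(J_N)(𝔸_F)` whose «transition entry» `(x g⁻¹)_{N,1}` is a PRINCIPAL unit `a ∈ E^×`, `1 ≤ h(e_N x) · h(e_N g)` and
  `H(x) · H(g) ≤ 1` — Godement's pairing inequality `|x·y|_𝔸 ≤ h(x) h(y)` (★ `ideleNorm_le_vecHeight_mul_vecHeight`) for `e_N x` and the first column of `g⁻¹` (★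
  `vecHeight_inv_col_zero`), whose pairing is `(x g⁻¹)_{N,1}` (★ `lastRow_dotProduct_inv_col`), of idèle norm `1` by the product formula (★ `ideleNorm_principal`).  The ★ rational
  lemma `borelHeight_toAdelic_mul_mul_borelHeight_le_one` is the case `x = ι(γ) g`.
* §2 **THE TRANSITION ENTRY OF `w₀ n`**: `(ι(J_N) · n)_{N,1} = (J_N)_{N,1} · n_{1,1} = 1` for `n ∈ N(𝔸_F)` (upper unitriangular).
* §3 **`H(ι(J_N) n g) · H(g) ≤ 1`** for all `n ∈ N(𝔸_F)`, `g ∈ U(J_N)(𝔸_F)`; hence `H(ι(J_N) n g) ≤ H(g)⁻¹`, `< 1` when `H(g) > 1`, `< T⁻¹` when `H(g) > T > 0` — what R6c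
  («`(Λ^T E f)_B = 0` on `{H > T}`: `M(𝟙_{>T} M f)(g) = 0` because every `w₀ n g` has height `< T⁻¹ < 1 < T`») and R6d consume; and the `B(𝔸_F)`-translate
  `H(b ι(J_N) n g) · H(g) ≤ ‖b_{NN}‖_𝔸⁻¹` (★ `borelHeight_borel_mul`).

HONEST LABEL.  Count-neutral helper; proves no printed statement; HC_CM is proved only modulo the 7 printed citations (2 remaining named inputs: hLiu418 =
`stmt-HodgeConjecture-24832`, h413 = `stmt-HodgeConjecture-24833`) until rung 0 closes.

## References
* [Garrett2018] P. Garrett, *Modern Analysis of Automorphic Forms by Example* 1 (2018), §1.5, §2.2–§2.3 (`η(w n g) η(g) ≤ 1`).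
* [Godement1964] R. Godement, *Domaines fondamentaux des groupes arithmétiques*, Sém. Bourbaki 257 (1962/63), §1.1.
* [MoeglinWaldspurger1995] C. Mœglin, J.-L. Waldspurger, *Spectral decomposition and Eisenstein series* (1995), I.2.2, II.1.7.
-/

set_option autoImplicit false
set_option linter.dupNamespace false  -- the mandated namespace repeats the summit's segment (`HodgeConjecture.HodgeConjecture`)

noncomputable section
open NumberField IsDedekindDomain Matrix
open Literature.NumberTheory.Automorphic Literature.NumberTheory.Automorphic.UnitaryGroup AdelicGroupData
open scoped MatrixGroups NNReal

namespace Summit.HodgeConjecture.HodgeConjecture.Cruxes.H413.K2E1BorelHeightWeylUnipotent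

variable {F E : Type} [Field F] [NumberField F] [Field E] [NumberField E] [Algebra F E] {c : E ≃ₐ[F] E} {N : ℕ} [NeZero N]

/-! ## §1 The general adelic big cell: principal transition entry ⟹ `H(x)·H(g) ≤ 1` -/

section General

/-- **`1 ≤ h(e_N x) · h(e_N g)` WHENEVER `(x g⁻¹)_{N,1}` IS A PRINCIPAL UNIT**: Godement's pairing inequality for `e_N x` and the first column of `g⁻¹` (height `h(e_N g)`,
★ `vecHeight_inv_col_zero`), whose pairing `(x g⁻¹)_{N,1} = a ∈ E^×` has idèle norm `1`. [cite: Godement1964, §1.1] [cite: Garrett2018, §2.2] -/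
theorem one_le_vecHeight_lastRow_mul_of_apply_eq_algebraMap (x g : (quasiSplit F E c N).Adelic) (a : Eˣ)
    (h : (adelicVal F E c N _ (x * g⁻¹) : Matrix (Fin N) (Fin N) (AdeleRing (𝓞 E) E)) ⊤ 0 = algebraMap E (AdeleRing (𝓞 E) E) a) :
    1 ≤ vecHeight E (lastRow x) * vecHeight E (lastRow g) := by
  have hnorm : IdeleClassGroup.ideleNorm E (Units.map (algebraMap E (AdeleRing (𝓞 E) E) : E →* AdeleRing (𝓞 E) E) a) = 1 :=
    ideleNorm_principal ⟨a, rfl⟩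
  rw [← hnorm, ← vecHeight_inv_col_zero g]
  exact ideleNorm_le_vecHeight_mul_vecHeight (isHeightFinite_lastRow _) (isHeightFinite_inv_col_zero g) _
    (by rw [Units.coe_map, lastRow_dotProduct_inv_col, h]; rfl)

/-- **THE GENERAL ADELIC BIG CELL `H(x) · H(g) ≤ 1`** whenever the transition entry `(x g⁻¹)_{N,1}` is a principal unit. [cite: Garrett2018, §1.5 and §2.3] -/
theorem borelHeight_mul_borelHeight_le_one_of_apply_eq_algebraMap (x g : (quasiSplit F E c N).Adelic) (a : Eˣ)
    (h : (adelicVal F E c N _ (x * g⁻¹) : Matrix (Fin N) (Fin N) (AdeleRing (𝓞 E) E)) ⊤ 0 = algebraMap E (AdeleRing (𝓞 E) E) a) :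
    borelHeight x * borelHeight g ≤ 1 := by
  rw [borelHeight_def, borelHeight_def, ← mul_inv]
  exact inv_le_one_of_one_le₀ (one_le_vecHeight_lastRow_mul_of_apply_eq_algebraMap x g a h)

/-- The case of transition entry `1`: `(x g⁻¹)_{N,1} = 1 ⟹ H(x) · H(g) ≤ 1`. [cite: Garrett2018, §1.5 and §2.3] -/
theorem borelHeight_mul_borelHeight_le_one_of_apply_eq_one (x g : (quasiSplit F E c N).Adelic)
    (h : (adelicVal F E c N _ (x * g⁻¹) : Matrix (Fin N) (Fin N) (AdeleRing (𝓞 E) E)) ⊤ 0 = 1) :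
    borelHeight x * borelHeight g ≤ 1 :=
  borelHeight_mul_borelHeight_le_one_of_apply_eq_algebraMap x g 1 (by rw [h, Units.val_one, map_one])

end General

/-! ## §2 The transition entry of `w₀ n`, `n ∈ N(𝔸_F)` -/

section Entry

omit [NumberField F] [NumberField E] [Algebra F E] in
/-- `rev 0 = ⊤` in `Fin N` (index plumbing, as in ★ `UnitaryGroupBorelHeightBigCell`). [folklore] -/
private theorem rev_zero_eq_top : Fin.rev (0 : Fin N) = ⊤ := by
  apply Fin.eq_of_val_eq
  rw [Fin.val_rev, Fin.val_zero]
  obtain ⟨n, rfl⟩ := Nat.exists_eq_succ_of_ne_zero (NeZero.ne N)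
  rfl

omit [NumberField F] [NumberField E] [Algebra F E] in
/-- `rev ⊤ = 0` in `Fin N`. [folklore] -/
private theorem rev_top_eq_zero : Fin.rev (⊤ : Fin N) = 0 := by
  rw [← rev_zero_eq_top, Fin.rev_rev]

/-- **`(J_N)_{N,1} = 1` adelically**: the bottom-left entry of `ι(J_N) = ι(w₀)` is `1`. [cite: MoeglinWaldspurger1995, I.2.2] -/
theorem adelicVal_weylLongU_apply_top_zero :
    (adelicVal F E c N _ ((quasiSplit F E c N).toAdelic (weylLongU (c : E →+* E) (rfl : (StdForm.antidiagonal N).over E = (StdForm.antidiagonal N).over E))) :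
      Matrix (Fin N) (Fin N) (AdeleRing (𝓞 E) E)) ⊤ 0 = 1 := by
  change algebraMap E (AdeleRing (𝓞 E) E)
      ((((weylLongU (c : E →+* E) (rfl : (StdForm.antidiagonal N).over E = (StdForm.antidiagonal N).over E) :
        ↥(unitaryGroupOfForm (c : E →+* E) ((StdForm.antidiagonal N).over E))) : GL (Fin N) E) : Matrix (Fin N) (Fin N) E) ⊤ 0) = 1
  rw [coe_coe_weylLongU, StdForm.antidiagonal_over_apply, if_pos rev_top_eq_zero.symm, map_one]

/-- **THE TRANSITION ENTRY OF `w₀ n` IS `1`**: `(ι(J_N) · n)_{N,1} = Σ_k (J_N)_{N,k} n_{k,1} = (J_N)_{N,1} · n_{1,1} = 1` for `n ∈ N(𝔸_F)` (upper unitriangular: `n_{k,1} = 0`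
for `k > 1`, `n_{1,1} = 1`). [cite: MoeglinWaldspurger1995, I.2.2] -/
theorem adelicVal_weylLongU_mul_apply_top_zero {n : (quasiSplit F E c N).Adelic} (hn : n ∈ adelicUnipotent F E c N) :
    (adelicVal F E c N _ ((quasiSplit F E c N).toAdelic (weylLongU (c : E →+* E) (rfl : (StdForm.antidiagonal N).over E = (StdForm.antidiagonal N).over E)) * n) :
      Matrix (Fin N) (Fin N) (AdeleRing (𝓞 E) E)) ⊤ 0 = 1 := by
  obtain ⟨hbt, hdiag⟩ := (mem_upperUnitriangular_iff _).1 ((mem_adelicUnipotent_iff n).1 hn)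
  rw [map_mul, Units.val_mul, Matrix.mul_apply, Finset.sum_eq_single (0 : Fin N) (fun k _ hk => ?_) (fun h => absurd (Finset.mem_univ _) h),
    hdiag 0, mul_one, adelicVal_weylLongU_apply_top_zero]
  rw [hbt ((Fin.pos_iff_ne_zero).2 hk), mul_zero]

/-- The transition entry of `x = ι(J_N) n g` against `g` is `1`: `((ι(J_N) n g) g⁻¹)_{N,1} = 1`. [cite: MoeglinWaldspurger1995, I.2.2] -/
theorem adelicVal_weylLongU_mul_mul_mul_inv_apply_top_zero {n : (quasiSplit F E c N).Adelic} (hn : n ∈ adelicUnipotent F E c N) (g : (quasiSplit F E c N).Adelic) :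
    (adelicVal F E c N _ ((quasiSplit F E c N).toAdelic (weylLongU (c : E →+* E) (rfl : (StdForm.antidiagonal N).over E = (StdForm.antidiagonal N).over E)) * n * g * g⁻¹) :
      Matrix (Fin N) (Fin N) (AdeleRing (𝓞 E) E)) ⊤ 0 = 1 := by
  rw [mul_inv_cancel_right, adelicVal_weylLongU_mul_apply_top_zero hn]

end Entry

/-! ## §3 `H(ι(J_N) n g) · H(g) ≤ 1` for every `n ∈ N(𝔸_F)` -/

section WeylUnipotent

/-- **THE ADELIC BIG CELL FOR `w₀ N(𝔸_F)`: `H(ι(J_N) · n · g) · H(g) ≤ 1`** for EVERY `n ∈ N(𝔸_F)` (not only rational) and every `g ∈ U(J_N)(𝔸_F)` — Garrett's `η(w n g) η(g) ≤ 1`,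
constant ONE; the inequality behind «at height `> T ≥ 1` the tail `E(𝟙_{>T} M f)` has at most one term» and «`M(𝟙_{>T}·)(g) = 0` for `H(g) > T⁻¹`» (SPEC EIS-R6 rungs R6b∕R6c).
[cite: Garrett2018, §1.5 and §2.3] [cite: MoeglinWaldspurger1995, II.1.7] -/
theorem borelHeight_weylLongU_unipotent_mul_mul_borelHeight_le_one {n : (quasiSplit F E c N).Adelic} (hn : n ∈ adelicUnipotent F E c N)
    (g : (quasiSplit F E c N).Adelic) :
    borelHeight ((quasiSplit F E c N).toAdelic (weylLongU (c : E →+* E) (rfl : (StdForm.antidiagonal N).over E = (StdForm.antidiagonal N).over E)) * n * g) *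
      borelHeight g ≤ 1 :=
  borelHeight_mul_borelHeight_le_one_of_apply_eq_one _ g (adelicVal_weylLongU_mul_mul_mul_inv_apply_top_zero hn g)

/-- Subtype spelling (`v : ↥N(𝔸_F)`, the integration variable of `M(w₀)`): `H(ι(J_N) · v · g) · H(g) ≤ 1`. [cite: Garrett2018, §1.5 and §2.3] -/
theorem borelHeight_weylLongU_coe_mul_mul_borelHeight_le_one (v : ↥(adelicUnipotent F E c N)) (g : (quasiSplit F E c N).Adelic) :
    borelHeight ((quasiSplit F E c N).toAdelic (weylLongU (c : E →+* E) (rfl : (StdForm.antidiagonal N).over E = (StdForm.antidiagonal N).over E)) *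
        (v : (quasiSplit F E c N).Adelic) * g) * borelHeight g ≤ 1 :=
  borelHeight_weylLongU_unipotent_mul_mul_borelHeight_le_one v.2 g

/-- **`H(ι(J_N) n g) ≤ H(g)⁻¹`** (`H(g) ≠ 0`). [cite: Garrett2018, §1.5 and §2.3] -/
theorem borelHeight_weylLongU_unipotent_mul_le_inv {n : (quasiSplit F E c N).Adelic} (hn : n ∈ adelicUnipotent F E c N)
    {g : (quasiSplit F E c N).Adelic} (hg : borelHeight g ≠ 0) :
    borelHeight ((quasiSplit F E c N).toAdelic (weylLongU (c : E →+* E) (rfl : (StdForm.antidiagonal N).over E = (StdForm.antidiagonal N).over E)) * n * g) ≤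
      (borelHeight g)⁻¹ := by
  rw [NNReal.le_inv_iff_mul_le hg]
  exact borelHeight_weylLongU_unipotent_mul_mul_borelHeight_le_one hn g

/-- **At most one of `g`, `w₀ n g` is high**: `1 < H(g) ⟹ H(ι(J_N) n g) < 1`. [cite: Garrett2018, §2.3] -/
theorem borelHeight_weylLongU_unipotent_mul_lt_one {n : (quasiSplit F E c N).Adelic} (hn : n ∈ adelicUnipotent F E c N)
    {g : (quasiSplit F E c N).Adelic} (hg : 1 < borelHeight g) :
    borelHeight ((quasiSplit F E c N).toAdelic (weylLongU (c : E →+* E) (rfl : (StdForm.antidiagonal N).over E = (StdForm.antidiagonal N).over E)) * n * g) < 1 := by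
  have h1 := borelHeight_weylLongU_unipotent_mul_mul_borelHeight_le_one hn g
  by_contra h
  rw [not_lt] at h
  have h2 : (1 : ℝ≥0) < borelHeight ((quasiSplit F E c N).toAdelic (weylLongU (c : E →+* E)
      (rfl : (StdForm.antidiagonal N).over E = (StdForm.antidiagonal N).over E)) * n * g) * borelHeight g :=
    lt_of_lt_of_le (by rw [one_mul]; exact hg) (mul_le_mul' h le_rfl)
  exact absurd h1 (not_le.mpr h2)

/-- **THE R6c INEQUALITY «`H(w₀ n g) < T⁻¹`»**: if `0 < T < H(g)` then `H(ι(J_N) n g) < T⁻¹` for every `n ∈ N(𝔸_F)` — so for `T ≥ 1` no `w₀ n g` lies in `{H > T}`, and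
`M(𝟙_{>T}·φ)(g) = 0` there. [cite: Garrett2018, §2.3] [cite: MoeglinWaldspurger1995, II.1.7] -/
theorem borelHeight_weylLongU_unipotent_mul_lt_inv {n : (quasiSplit F E c N).Adelic} (hn : n ∈ adelicUnipotent F E c N)
    {g : (quasiSplit F E c N).Adelic} {T : ℝ≥0} (hT₀ : 0 < T) (hT : T < borelHeight g) :
    borelHeight ((quasiSplit F E c N).toAdelic (weylLongU (c : E →+* E) (rfl : (StdForm.antidiagonal N).over E = (StdForm.antidiagonal N).over E)) * n * g) < T⁻¹ := by
  have hg : borelHeight g ≠ 0 := (hT₀.trans hT).ne'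
  exact (borelHeight_weylLongU_unipotent_mul_le_inv hn hg).trans_lt (NNReal.inv_lt_inv hT₀.ne' hT)

/-- For `1 ≤ T < H(g)`: `H(ι(J_N) n g) < T⁻¹ ≤ 1 ≤ T`, so `¬ (T < H(ι(J_N) n g))` — the cut-off `𝟙_{>T}` kills every `w₀ n g`. [cite: Garrett2018, §2.3] -/
theorem not_lt_borelHeight_weylLongU_unipotent_mul {n : (quasiSplit F E c N).Adelic} (hn : n ∈ adelicUnipotent F E c N)
    {g : (quasiSplit F E c N).Adelic} {T : ℝ≥0} (hT₁ : 1 ≤ T) (hT : T < borelHeight g) :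
    ¬ T < borelHeight ((quasiSplit F E c N).toAdelic (weylLongU (c : E →+* E) (rfl : (StdForm.antidiagonal N).over E = (StdForm.antidiagonal N).over E)) * n * g) := by
  have hlt := borelHeight_weylLongU_unipotent_mul_lt_inv hn (zero_lt_one.trans_le hT₁) hT
  exact not_lt.2 ((hlt.le.trans (inv_le_one_of_one_le₀ hT₁)).trans hT₁)

/-- **WITH A BOREL PREFACTOR**: `H(b · ι(J_N) n g) · H(g) ≤ ‖b_{NN}‖_𝔸⁻¹` for `b ∈ B(𝔸_F)` (★ `borelHeight_borel_mul`) — every element of the big cell `B(𝔸) w₀ N(𝔸)` against `g`.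
[cite: Garrett2018, §2.2–§2.3] -/
theorem borelHeight_borel_weylLongU_unipotent_mul_mul_borelHeight_le {b n : (quasiSplit F E c N).Adelic} (hb : b ∈ borelAdelic F E c N)
    (hn : n ∈ adelicUnipotent F E c N) (g : (quasiSplit F E c N).Adelic) :
    borelHeight (b * ((quasiSplit F E c N).toAdelic (weylLongU (c : E →+* E) (rfl : (StdForm.antidiagonal N).over E = (StdForm.antidiagonal N).over E)) * n * g)) *
        borelHeight g ≤ (IdeleClassGroup.ideleNorm E (lastEntryUnit hb))⁻¹ := by
  rw [borelHeight_borel_mul hb, mul_assoc]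
  exact mul_le_of_le_one_right zero_le (borelHeight_weylLongU_unipotent_mul_mul_borelHeight_le_one hn g)

end WeylUnipotent

end Summit.HodgeConjecture.HodgeConjecture.Cruxes.H413.K2E1BorelHeightWeylUnipotent

end
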